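/-
Copyright (c) 2026 the pub-hodgecm-mathlib formalisation cell (harness21).  Prover seat hodgecm-mathlib-K2E1-p14 (g2), Track B «K2-LIT» ENGINE E1, h413 =
`stmt-HodgeConjecture-24833`, route `HCCMUnconditional` — R90-TF LEAD #11 SIGN BYTE-GUARD: what the ★ package bytes decide about the centre value `s(½)` of the rank-one scattering
scalar of a self-dual unitary `χ` at the maximal level: `s(½) = 1 ∨ s(½) = −1`, nothing more.
-/
import Summits.HodgeConjecture.HodgeConjecture.Theorems.K2E1ChiUnitaryAxisContinuationCMTwo        -- ★ p860080 (K2E1-p13): `analyticAt_of_re_eq_half_of_fe_of_conj` (+ ★ `eventually_one_sub_notMem_and_conj_notMem`)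
import Summits.HodgeConjecture.HodgeConjecture.Theorems.K2E1ChiScatteringFunctionalEquationM1CMTwo    -- ★ p860766 (K2E1-p13): `chi_scattering_fe_m1_cm_two`
import Summits.HodgeConjecture.HodgeConjecture.Theorems.K2E1ChiScatteringConjSymmetryM1CMTwo         -- ★ p860445 (K2E1-p13): `chi_scattering_conj_symm_m1_cm_two`, `exists_galTwist_cm`
import Summits.HodgeConjecture.HodgeConjecture.Theorems.K2E1ChiSectionSpaceU2Defs                   -- ★ D1: `chiSectionSpace`, `apply_mul_of_mem`, `isChiSection_of_mem`
import HarnessLib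

/-!
# `K2E1ChiScatteringCentreValueSignM1CMTwo` — THE CENTRE VALUE OF THE RANK-ONE SCATTERING SCALAR IS `±1` (R90-TF LEAD #11 SIGN BYTE-GUARD)

Track B ∕ K2-LIT, crux h413 = `stmt-HodgeConjecture-24833`, route of record `HCCMUnconditional`; cell `hodgecm-mathlib`, squad K2, ENGINE E1.  THEOREMS ONLY (no `def`, no `instance`,
no `notation`, no named-fact hypothesis, no `sorry`; default heartbeats); lane `--supports stmt-HodgeConjecture-24833 --as helper` (count-neutral).

THE MATHEMATICS ([MoeglinWaldspurger1995, IV.1.10, IV.3.12]; [Iwaniec2002, Thm 6.6]).  For a scalar `c` meromorphic in normal form on `ℂ`, analytic off a co-discrete `P`, with the functional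
equation `c(z)c(1 − z) = 1` and the conj-symmetry `c(conj z) = conj c(z)` off `P`: `c` is analytic at `½` (★ `analyticAt_of_re_eq_half_of_fe_of_conj`), and letting `z → ½` off `P ∪ (1 − P)`
in the functional equation gives `c(½)² = 1`, i.e. **`c(½) = 1 ∨ c(½) = −1`** (§1, kernel-free).  §2 reads it on the PINNED M1 package of a self-dual unitary `χ` (★ p860766 (FE), ★ p860445
(conj) on the tube clause): the ★ bytes decide `s(½) ∈ {±1}` and NOT the sign — the sign is the centre value of the intertwining `L`-ratio, a separate statement (LEAD #11: type
`sock_S8_ext_kysCentreU2` sign-parametric, or with an explicit `stub_` for the sign).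
* §1 `apply_half_eq_one_or_eq_neg_one_of_fe_of_conj`.  * §2 HEAD **`chi_scattering_centre_value_sq_m1_cm_two`** (on the package clauses).
HONEST LABEL: HC_CM is proved only modulo the 7 printed citations (2 remaining named inputs: hLiu418 = `stmt-HodgeConjecture-24832`, h413 = `stmt-HodgeConjecture-24833`) until rung 0
closes; this file asserts no named fact, closes no socket; count-neutral; letters: the package clauses only.

## References
* [MoeglinWaldspurger1995] C. Mœglin, J.-L. Waldspurger, *Spectral decomposition and Eisenstein series* (1995), IV.1.10, IV.3.12.
* [Iwaniec2002] H. Iwaniec, *Spectral Methods of Automorphic Forms* (2nd ed., 2002), §6.3 Thm 6.6.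
-/

set_option autoImplicit false
set_option linter.dupNamespace false  -- the mandated namespace repeats the summit's segment (`HodgeConjecture.HodgeConjecture`)

noncomputable section

open MeasureTheory Measure Set Filter Topology Complex NumberField IsDedekindDomain
open scoped Real NNReal ENNReal ComplexConjugate
open Literature.MeasureTheory.Group Literature.NumberTheory Literature.NumberTheory.Automorphic Literature.NumberTheory.Automorphic.UnitaryGroup AdelicGroupData
open Literature.NumberTheory.GaloisRepresentations (HeckeCharacter)
open Summit.HodgeConjecture.HodgeConjecture.Cruxes.H413.K2E1BorelEisensteinU
open Summit.HodgeConjecture.HodgeConjecture.Cruxes.H413.K2E1BLBorelSpacesU2Defs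
open Summit.HodgeConjecture.HodgeConjecture.Cruxes.H413.K2E1BLBorelOperatorsU2Defs
open Summit.HodgeConjecture.HodgeConjecture.Cruxes.H413.K2E1CharacterEisensteinU2Defs
open Summit.HodgeConjecture.HodgeConjecture.Cruxes.H413.K2E1ChiSectionSpaceU2Defs
open Summit.HodgeConjecture.HodgeConjecture.Cruxes.H413.K2E1ChiUnitaryAxisContinuationCMTwo (analyticAt_of_re_eq_half_of_fe_of_conj)
open Summit.HodgeConjecture.HodgeConjecture.Cruxes.H413.K2E1ScalarUnitaryAxisContinuationCMTwo (eventually_one_sub_notMem_and_conj_notMem)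
open Summit.HodgeConjecture.HodgeConjecture.Cruxes.H413.K2E1ChiScatteringFunctionalEquationM1CMTwo (chi_scattering_fe_m1_cm_two)
open Summit.HodgeConjecture.HodgeConjecture.Cruxes.H413.K2E1ChiScatteringConjSymmetryM1CMTwo (chi_scattering_conj_symm_m1_cm_two exists_galTwist_cm)

namespace Summit.HodgeConjecture.HodgeConjecture.Cruxes.H413.K2E1ChiScatteringCentreValueSignM1CMTwo

/-! ## §1 Kernel-free: (FE) + (conj) ⇒ `c(½) = ±1` -/

/-- **THE CENTRE VALUE OF A SELF-DUAL SCATTERING SCALAR IS `±1`.**  `c` meromorphic in normal form on `ℂ`, `P` co-discrete, (FE) `c(z)c(1 − z) = 1` off `P ∪ (1 − P)`, (conj) off `P ∪ conj P`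
⟹ `c(½) = 1 ∨ c(½) = −1`: `c` is analytic at `½` (★ `analyticAt_of_re_eq_half_of_fe_of_conj`), and the functional equation passes to the limit `z → ½` along `𝓝[≠] ½` (which avoids
`P ∪ (1 − P)` eventually). [cite: MoeglinWaldspurger1995, IV.1.10 and IV.3.12] [cite: Iwaniec2002, Thm 6.6] -/
theorem apply_half_eq_one_or_eq_neg_one_of_fe_of_conj {P : Set ℂ} {c : ℂ → ℂ} (hcNF : MeromorphicNFOn c univ) (hPcd : ∀ z₀ : ℂ, ∀ᶠ w in 𝓝[≠] z₀, w ∉ P)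
    (hFE : ∀ z : ℂ, z ∉ P → 1 - z ∉ P → c z * c (1 - z) = 1) (hconj : ∀ z : ℂ, z ∉ P → conj z ∉ P → c (conj z) = conj (c z)) :
    c (1 / 2) = 1 ∨ c (1 / 2) = -1 := by
  have hhalf : ((1 / 2 : ℂ)).re = 1 / 2 := by norm_num
  have han : AnalyticAt ℂ c (1 / 2) := analyticAt_of_re_eq_half_of_fe_of_conj hcNF hPcd hFE hconj hhalf
  -- `z ↦ c z * c (1 − z)` tends to `c(½) * c(½)` along `𝓝[≠] ½` and equals `1` eventually there
  have h1 : Tendsto (fun z : ℂ => c z * c (1 - z)) (𝓝[≠] (1 / 2 : ℂ)) (𝓝 (c (1 / 2) * c (1 / 2))) := by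
    have hc2 : Tendsto (fun z : ℂ => c (1 - z)) (𝓝 (1 / 2 : ℂ)) (𝓝 (c (1 / 2))) := by
      have h' : Tendsto (fun z : ℂ => 1 - z) (𝓝 (1 / 2 : ℂ)) (𝓝 ((1 : ℂ) - 1 / 2)) := (continuous_const.sub continuous_id).tendsto (1 / 2)
      have e : (1 : ℂ) - 1 / 2 = 1 / 2 := by norm_num
      rw [e] at h'
      exact han.continuousAt.tendsto.comp h'
    exact (han.continuousAt.tendsto.mul hc2).mono_left nhdsWithin_le_nhds
  have hev : ∀ᶠ z : ℂ in 𝓝[≠] (1 / 2 : ℂ), c z * c (1 - z) = 1 := by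
    filter_upwards [hPcd (1 / 2), eventually_one_sub_notMem_and_conj_notMem hPcd (1 / 2)] with z hz h1z
    exact hFE z hz h1z.1
  have hsq : c (1 / 2) * c (1 / 2) = 1 := tendsto_nhds_unique h1 (tendsto_const_nhds.congr' (hev.mono fun z hz => hz.symm))
  exact mul_self_eq_one_iff.1 hsq

/-! ## §2 HEAD: on the pinned M1 package of a self-dual unitary `χ` -/

section CM

variable (L : Type) [Field L] [NumberField L] [IsCMField L]
variable [MeasurableSpace (quasiSplit (↥(maximalRealSubfield L)) L (IsCMField.complexConj L) 2).Adelic] [BorelSpace (quasiSplit (↥(maximalRealSubfield L)) L (IsCMField.complexConj L) 2).Adelic]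

/-- **HEAD — `s(½) = 1 ∨ s(½) = −1` FOR THE RANK-ONE SCATTERING SCALAR `s = qc default` OF A SELF-DUAL UNITARY `χ` AT THE MAXIMAL LEVEL, ON THE PINNED PACKAGE'S CLAUSES** (the structural
data of ★ σ2; the normalised M1 section `φ`; the clauses `hqφ hqNF hqcq hPc hPcd hPre hqa` and the tube formula `hs_tube`).  (FE) := ★ `chi_scattering_fe_m1_cm_two`, (conj) := ★
`chi_scattering_conj_symm_m1_cm_two` on `hs_tube`, then §1.  The ★ bytes decide NO MORE than this: the sign itself is the centre value of the intertwining `L`-ratio.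
[cite: MoeglinWaldspurger1995, IV.1.10 and IV.3.12] [cite: Iwaniec2002, Thm 6.6] -/
theorem chi_scattering_centre_value_sq_m1_cm_two
    (μ : Measure (quasiSplit (↥(maximalRealSubfield L)) L (IsCMField.complexConj L) 2).automorphicQuotient) [(quasiSplit (↥(maximalRealSubfield L)) L (IsCMField.complexConj L) 2).IsAutomorphicMeasure μ]
    (νG : Measure (quasiSplit (↥(maximalRealSubfield L)) L (IsCMField.complexConj L) 2).Adelic) [νG.IsHaarMeasure] [νG.IsInvInvariant] [SFinite νG]
    (ν : Measure ↥(adelicUnipotent (↥(maximalRealSubfield L)) L (IsCMField.complexConj L) 2)) [ν.IsHaarMeasure] [ν.IsMulRightInvariant] [ν.IsInvInvariant]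
    {𝓕 : Set ↥(adelicUnipotent (↥(maximalRealSubfield L)) L (IsCMField.complexConj L) 2)}
    (h𝓕N : IsFundamentalDomain ↥(rationalUnipotent (↥(maximalRealSubfield L)) L (IsCMField.complexConj L) 2) 𝓕 ν) (h𝓕c : IsCompact (closure 𝓕)) (h𝓕₀ : ν 𝓕 ≠ 0)
    {β : (quasiSplit (↥(maximalRealSubfield L)) L (IsCMField.complexConj L) 2).Adelic → ℝ≥0∞}
    (hβ : IsCoveringWeight ↥((arithmeticBorel (↥(maximalRealSubfield L)) L (IsCMField.complexConj L) 2).map (quasiSplit (↥(maximalRealSubfield L)) L (IsCMField.complexConj L) 2).arithmeticSubgroup.subtype) β)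
    {μZ : Measure (borelQuotient (↥(maximalRealSubfield L)) L (IsCMField.complexConj L) 2)} [SFinite μZ]
    (hμZ : ∀ f : borelQuotient (↥(maximalRealSubfield L)) L (IsCMField.complexConj L) 2 → ℝ≥0∞, Measurable f → ∫⁻ z, f z ∂μZ = ∫⁻ g, β g * f (toBorelQuotient (↥(maximalRealSubfield L)) L (IsCMField.complexConj L) 2 g) ∂νG)
    {χ : HeckeCharacter L} (hχ : χ.IsUnitary) (hsd : reflectChar (IsCMField.complexConj L) χ = χ)
    {φ : (quasiSplit (↥(maximalRealSubfield L)) L (IsCMField.complexConj L) 2).Adelic → ℂ} (hφV : φ ∈ chiSectionSpace χ ((standardMaximalCompactGL 2 L).comap (adelicVal (↥(maximalRealSubfield L)) L (IsCMField.complexConj L) 2 ((StdForm.antidiagonal 2).over L)) : Subgroup (quasiSplit (↥(maximalRealSubfield L)) L (IsCMField.complexConj L) 2).Adelic) (fun _ => 1)) (hφc : Continuous φ) {Mφ : ℝ} (hφM : ∀ x, ‖φ x‖ ≤ Mφ)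
    (hφinf : ∀ a : arch (↥(maximalRealSubfield L)) L (IsCMField.complexConj L) 2 ((StdForm.antidiagonal 2).over L), φ (archToAdelic (↥(maximalRealSubfield L)) L (IsCMField.complexConj L) 2 _ a) = φ 1)
    (hφ1 : φ 1 ≠ 0) (hφ1r : conj (φ 1) = φ 1)
    {q qc : Unit → ℂ → ℂ} {P : Set ℂ}
    (hqφ : ∀ z : ℂ, 1 < z.re → (∑ j, q j z • φ) = ((((ν 𝓕).toReal⁻¹ : ℝ)) : ℂ) • (fun g : (quasiSplit (↥(maximalRealSubfield L)) L (IsCMField.complexConj L) 2).Adelic => (∫ v : ↥(adelicUnipotent (↥(maximalRealSubfield L)) L (IsCMField.complexConj L) 2), flatSectionU φ z ((quasiSplit (↥(maximalRealSubfield L)) L (IsCMField.complexConj L) 2).toAdelic (weylLongU ((IsCMField.complexConj L : L ≃ₐ[↥(maximalRealSubfield L)] L) : L →+* L) (rfl : (StdForm.antidiagonal 2).over L = (StdForm.antidiagonal 2).over L)) * ((v : (quasiSplit (↥(maximalRealSubfield L)) L (IsCMField.complexConj L) 2).Adelic) * g)) ∂ν) * (((borelHeight g : ℝ) : ℂ)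 ^ (z - 1))))
    (hqNF : ∀ j, MeromorphicNFOn (qc j) univ) (hqcq : ∀ j (z : ℂ), 1 < z.re → qc j z = q j z)
    (hPc : IsClosed P) (hPcd : ∀ z₀ : ℂ, ∀ᶠ s in 𝓝[≠] z₀, s ∉ P) (hPre : ∀ z ∈ P, z.re ≤ 1) (hqa : ∀ j (z : ℂ), z ∉ P → AnalyticAt ℂ (qc j) z)
    (hs_tube : ∀ z : ℂ, 1 < z.re → qc default z = (((ν 𝓕).toReal⁻¹ : ℝ) : ℂ) * ((φ 1)⁻¹ * ∫ v : ↥(adelicUnipotent (↥(maximalRealSubfield L)) L (IsCMField.complexConj L) 2), flatSectionU φ z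
        ((quasiSplit (↥(maximalRealSubfield L)) L (IsCMField.complexConj L) 2).toAdelic (weylLongU (IsCMField.complexConj L : L →+* L)
          (rfl : (StdForm.antidiagonal 2).over L = (StdForm.antidiagonal 2).over L)) * ((v : (quasiSplit (↥(maximalRealSubfield L)) L (IsCMField.complexConj L) 2).Adelic) * 1)) ∂ν)) :
    qc default (1 / 2) = 1 ∨ qc default (1 / 2) = -1 := by
  have hφ0 : φ ≠ 0 := fun h => hφ1 (by rw [h, Pi.zero_apply])
  have hFE : ∀ z : ℂ, z ∉ P → 1 - z ∉ P → qc default z * qc default (1 - z) = 1 :=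
    chi_scattering_fe_m1_cm_two L μ νG ν h𝓕N h𝓕c h𝓕₀ hβ hμZ hsd hφV hφc hφM hφinf hφ0 hqφ hqcq hPc hPcd hPre hqa
  have hφK : ∀ k : (quasiSplit (↥(maximalRealSubfield L)) L (IsCMField.complexConj L) 2).Adelic,
      adelicVal (↥(maximalRealSubfield L)) L (IsCMField.complexConj L) 2 ((StdForm.antidiagonal 2).over L) k ∈ standardMaximalCompactGL 2 L → ∀ g, φ (g * k) = φ g :=
    fun k hk g => by simpa only [one_mul] using apply_mul_of_mem hφV g ⟨k, hk⟩
  have hconj : ∀ z : ℂ, z ∉ P → conj z ∉ P → qc default (conj z) = conj (qc default z) := by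
    obtain ⟨cG, hcG⟩ := exists_galTwist_cm L
    exact chi_scattering_conj_symm_m1_cm_two L hcG ν ((ν 𝓕).toReal⁻¹) hsd hχ (isChiSection_of_mem hφV) hφK hφ1r hφ1r hPc hPcd hPre (hqa default) hs_tube
  exact apply_half_eq_one_or_eq_neg_one_of_fe_of_conj (hqNF default) hPcd hFE hconj

end CM

end Summit.HodgeConjecture.HodgeConjecture.Cruxes.H413.K2E1ChiScatteringCentreValueSignM1CMTwo

end
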